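import Summits.KontsevichZagierPeriods.KontsevichZagierPeriods.Theses.HardSphereVirial
import Summits.KontsevichZagierPeriods.KontsevichZagierPeriods.Theorems.InverseLandauTateLiftingIsotropyPlane

/-!
# `IsotropyFactorisation2` (stmt-KontsevichZagierPeriods-10458, route HardSphereVirial) — candidate proof

The plane engine of route HardSphereVirial is the landed theorem
`Summit.KontsevichZagierPeriods.InverseLandau.tateLifting_isotropyPlane`
(`Theorems/InverseLandauTateLiftingIsotropyPlane.lean`, line `Sketch` of crux `TateLifting`, cycle c8).
-/

namespace Summit.KontsevichZagierPeriods.HardSphereVirial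

/-- **The plane engine** (route HardSphereVirial, `IsotropyFactorisation2`, stmt-KontsevichZagierPeriods-10458): for every
`ℚ`-semialgebraic `σ ⊆ (ℝ²)³` invariant under the diagonal action of `O(2)`, `[σ, 1] − [ℝ × τ, 2ρ/(1+u²)] ∈ KZ.relations`.
Proof: the landed `InverseLandau.tateLifting_isotropyPlane`. [cite: KontsevichZagier2001, §1.2 rule (2)] -/
theorem isotropyFactorisation2_proof :
    Summit.KontsevichZagierPeriods.KontsevichZagierPeriods.Theses.HardSphereVirial.IsotropyFactorisation2 :=
  Summit.KontsevichZagierPeriods.InverseLandau.tateLifting_isotropyPlane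

end Summit.KontsevichZagierPeriods.HardSphereVirial
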